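/-
Copyright (c) 2026 the pub-hodgecm-mathlib formalisation cell (harness21).  Prover seat hodgecm-mathlib-F0P3a-p05 (g18): road «S3-ram» (LEAD F0P3a-plan (g13);
owner F0P3a-p06), (Cnt2′) route B (chair F0P3a-p07 (g15) RULING (16)(b) «REGIME A-EVEN HYPERBOLIC», W-side), the TOP-vertex line counts; 2026-09-02.
-/
import Literature.NumberTheory.Automorphic.UnitaryLatticeTreeIsocelesVertexLineCountsRamified   -- ★ (V2) (LH4-p02): `natCard_params_pred_eq_of_shape`; brings ★ G3⁗ `ncard_neighborSet_pred_eq_natCard`, ★ `ringChar_residueField_ne_two`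
import HarnessLib

/-!
# The lattice graph of a hermitian space — PER-VERTEX LINE COUNTS at a TOP vertex of the hyperbolic type-(2) literal in regime A-even: the residual SHAPE
# `Q_Ȳ(x̄) = c·(x̄₁ + t x̄₂)² + l·x̄₂²` with `c = 0`, `l ≠ 0` (ONE null line, `q` lines of the one class `l`) (Kottwitz 1986 §3; Rogawski 1990 §4.9)

Topic `NumberTheory/Automorphic`; namespace `Literature.NumberTheory.Automorphic.UnitaryLatticeTree`.  THEOREMS ONLY (no definition, no instance, no notation, no named fact,
no `sorry`); kernel lane `--supports stmt-HodgeConjecture-24833`; datum-free.  Cell `pub/hodgecm-mathlib` (D-0151), crux H413; road «S3-ram» (Literature seeding,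
count-neutral); (Cnt2′) route B, chair RULING (16)(b): regime **A-even** of the hyperbolic literal `ι(B₀, 1)` (`N = 2n`, root level `d₀ = N − 1`).  At a vertex `v` of its
root region (the `q + 1` TOP vertices around the ϖ-modular W-centre) the residual value `Ȳ` is the NILPOTENT traceless `W`-part: in the adapted block frame of A-p12 (g25)'s
★ (K3)∕(K4a) the shape keys are `c̄ = res CO = 0` (the scalar root datum `b̄₀` vanishes, `d_c > d₀`) and `l̄ = res LO ≠ 0`, so on the cone the value is `l̄·x̄₂²`: the block
line `ē₀` is the ONLY null line and the other `q` isotropic lines all carry the ONE class `[l̄]` — the row «`A ≠ 0, C = 0`» of ★ `DepthZeroKappaTransferTypeTwoRamifiedCollarCensus`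
§3 plus the axial line.  ★ (V2) (`UnitaryLatticeTreeIsocelesVertexLineCountsRamified`) has the cases `c ≠ 0` (`l = 0` interior, `l ≠ 0` end); THIS FILE adds `c = 0`
through the same ★ `natCard_params_pred_eq_of_shape` (`#params(P) = [P 0] + #{s : P(l + c s²)}`):
* §1 (finite field): **`natCard_params_null_eq_one_of_shape_top`** (`c = 0`, `l ≠ 0`: ONE null line), **`natCard_params_quadraticChar_eq_of_shape_top`** (`c = 0`:
  `q·[χ(c₀l) = σ]` lines of class `σ`);
* §2 (lattice tree, ★ G3⁗'s residue test on the children `(uκ)·N₁` of `u·L₀`): **`ncard_children_null_eq_one_of_shape_top`**, **`ncard_children_quadraticChar_eq_of_shape_top`**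
  — binders = ★ (V2)'s with `(hc : c = 0)`.
Consumer: this seat's `blockVertexCensus_top` (the per-vertex engine-token values `(0, q·q·[χ(c₀l̄) = 1], q·q·[χ(c₀l̄) = −1])` at a top vertex, A-p12's ★ (K4a) template), then
F0P3-p03 (g16) ★ `regionCensus_block_of_kindCounts` with this seat's ★ kind multiplicities (`…WSideLatticeCurrencyTopKinds[GL]`, `…BlockRootRegionAxisTopClass`).
HONEST LABEL: HC_CM is proved only modulo the 2 remaining named inputs (hLiu418 24832, h413 24833) until rung 0 closes; finite-field ∕ residual bookkeeping over ★ results,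
nothing printed is asserted; «S3-ram» has no books consequence.

## References
* [Kottwitz1986] R. E. Kottwitz, *Base change for unit elements of Hecke algebras*, Compositio Math. 60 (1986), §3 (counting fixed lattices by residual data).
* [Rogawski1990] J. D. Rogawski, *Automorphic Representations of Unitary Groups in Three Variables*, Ann. of Math. Stud. 123 (1990), §4.9 Prop. 4.9.1 (b) pp. 54–56.
* [BruhatTits1972] F. Bruhat, J. Tits, *Groupes réductifs sur un corps local I*, Publ. Math. IHÉS 41 (1972), §10 (the star of a vertex = the residual conic).
* [IrelandRosen1990] K. Ireland, M. Rosen, *A Classical Introduction to Modern Number Theory*, 2nd ed. (1990), Ch. 8 §1 (the quadratic character).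
-/

set_option autoImplicit false

noncomputable section

open scoped Valued WithZero Matrix MatrixGroups
open Finset

namespace Literature.NumberTheory.Automorphic.UnitaryLatticeTree

open Literature.NumberTheory.Automorphic Literature.NumberTheory.Automorphic.HermitianLattice
open Literature.GroupTheory.SpecificGroups Literature.NumberTheory.Rogawski1990

/-! ## §1 Finite-field half: the shape with `c = 0` -/

section FiniteField

variable {k : Type*} [Field k] [Fintype k] [DecidableEq k]

/-- **TOP (`c = 0`, `l ≠ 0`): exactly ONE NULL line** (the block line `ē₀`; the other `q` isotropic lines have the value `l·s⁰ = l ≠ 0` in ★ (V2)'s parameter `s`).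
[cite: Kottwitz1986, §3] [cite: Rogawski1990, §4.9 Prop. 4.9.1 (b) p. 55] -/
theorem natCard_params_null_eq_one_of_shape_top (hk : ringChar k ≠ 2) (Y : Matrix (Fin 3) (Fin 3) k) {c : k} (hc : c = 0) (t : k) {l : k} (hl : l ≠ 0)
    (hshape : ∀ x : Fin 3 → k, 2 * x 0 * x 2 + x 1 ^ 2 = 0 → x ⬝ᵥ ((((StdForm.antidiagonal 3).over k) * Y) *ᵥ x) = c * (x 1 + t * x 2) ^ 2 + l * x 2 ^ 2) :
    Nat.card {p : Option {p : k × k // p.2 + (RingHom.id k) p.2 + p.1 * (RingHom.id k) p.1 = 0} //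
        (p.elim (Pi.single 2 1) fun q => ![(1 : k), q.1.1, q.1.2]) ⬝ᵥ
          ((((StdForm.antidiagonal 3).over k) * Y) *ᵥ (p.elim (Pi.single 2 1) fun q => ![(1 : k), q.1.1, q.1.2])) = 0} = 1 := by
  rw [natCard_params_pred_eq_of_shape hk Y c t l hshape (fun s => s = 0) (fun a s ha => by simp [ha]), hc]
  have h0 : (univ.filter fun s : k => (l + 0 * s ^ 2 = 0)).card = 0 := by
    rw [Finset.card_eq_zero, Finset.filter_eq_empty_iff]
    intro s _
    simpa using hl
  rw [h0]
  simp

/-- **TOP (`c = 0`): the lines whose value has class `σ` for the key `c₀` number `q·[χ(c₀l) = σ]`** — the `q` non-block lines all lie in the ONE class of `l`, and the block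
line is null (`χ(0) = 0 ≠ ±1`). [cite: Kottwitz1986, §3] [cite: Rogawski1990, §4.9 Prop. 4.9.1 (b) p. 55] [cite: IrelandRosen1990, Ch. 8 §1] -/
theorem natCard_params_quadraticChar_eq_of_shape_top (hk : ringChar k ≠ 2) (Y : Matrix (Fin 3) (Fin 3) k) {c : k} (hc : c = 0) (t l : k)
    (hshape : ∀ x : Fin 3 → k, 2 * x 0 * x 2 + x 1 ^ 2 = 0 → x ⬝ᵥ ((((StdForm.antidiagonal 3).over k) * Y) *ᵥ x) = c * (x 1 + t * x 2) ^ 2 + l * x 2 ^ 2)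
    (c₀ : k) {σ : ℤ} (hσ : σ = 1 ∨ σ = -1) :
    Nat.card {p : Option {p : k × k // p.2 + (RingHom.id k) p.2 + p.1 * (RingHom.id k) p.1 = 0} //
        quadraticChar k (c₀ * ((p.elim (Pi.single 2 1) fun q => ![(1 : k), q.1.1, q.1.2]) ⬝ᵥ
          ((((StdForm.antidiagonal 3).over k) * Y) *ᵥ (p.elim (Pi.single 2 1) fun q => ![(1 : k), q.1.1, q.1.2])))) = σ} =
      Fintype.card k * (if quadraticChar k (c₀ * l) = σ then 1 else 0) := by
  have hP : ∀ a s : k, a ≠ 0 → (quadraticChar k (c₀ * (a * a * s)) = σ ↔ quadraticChar k (c₀ * s) = σ) := fun a s ha => by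
    rw [show c₀ * (a * a * s) = c₀ * s * a ^ 2 by ring, map_mul, map_pow, quadraticChar_sq_one ha, mul_one]
  rw [natCard_params_pred_eq_of_shape hk Y c t l hshape (fun s => quadraticChar k (c₀ * s) = σ) hP, hc]
  have h0 : ¬ (quadraticChar k (c₀ * 0) = σ) := by
    rw [mul_zero, quadraticChar_zero]
    rcases hσ with rfl | rfl <;> decide
  rw [if_neg h0, zero_add]
  simp only [zero_mul, add_zero]
  by_cases h : quadraticChar k (c₀ * l) = σ
  · rw [if_pos h, mul_one, Finset.filter_true_of_mem (fun _ _ => h), Finset.card_univ]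
  · rw [if_neg h, mul_zero, Finset.filter_false_of_mem (fun _ _ => h), Finset.card_empty]

end FiniteField

/-! ## §2 Lattice half: the children of `u·L₀` at a top vertex -/

section Lattice

variable {K : Type*} [Field K] [Valued K ℤᵐ⁰] {σ : K →+* K} {ϖ : K}

/-- **TOP VERTEX: exactly ONE child with NULL line value** (★ G3⁗'s binders + the SHAPE on `Ȳ = Y₀ mod ϖ` with `c = 0`, `l ≠ 0`: the block neighbour `u·N₁`).
[cite: Kottwitz1986, §3] [cite: Rogawski1990, §4.9 Prop. 4.9.1 (b) p. 55] [cite: BruhatTits1972, §10] -/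
theorem ncard_children_null_eq_one_of_shape_top (hσ : ∀ x, σ (σ x) = x) (hvσ : ∀ a, Valued.v (σ a) = Valued.v a) (hσϖ : σ ϖ = -ϖ)
    (hϖ : Valued.v ϖ = WithZero.exp (-1 : ℤ)) (hres : ∀ x : K, Valued.v x ≤ 1 → Valued.v (σ x - x) < 1) (h2 : Valued.v (2 : K) = 1) [Finite 𝓀[K]]
    (u : unitaryGroupOfForm σ ((StdForm.antidiagonal 3).over K))
    {d : ℕ} (M : Matrix (Fin 3) (Fin 3) K) (Y₀ : Matrix (Fin 3) (Fin 3) 𝒪[K]) (hY₀ : ∀ i j, ((Y₀ i j : 𝒪[K]) : K) = (ϖ ^ d)⁻¹ * M i j)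
    {c : 𝓀[K]} (hc : c = 0) (t : 𝓀[K]) {l : 𝓀[K]} (hl : l ≠ 0)
    (hshape : ∀ x : Fin 3 → 𝓀[K], 2 * x 0 * x 2 + x 1 ^ 2 = 0 →
      x ⬝ᵥ ((((StdForm.antidiagonal 3).over 𝓀[K]) * Y₀.map (IsLocalRing.residue 𝒪[K])) *ᵥ x) = c * (x 1 + t * x 2) ^ 2 + l * x 2 ^ 2) :
    {w | w ∈ (latticeGraph σ ϖ ((StdForm.antidiagonal 3).over K)).neighborSet
          (latticeGraphIso σ ϖ ((StdForm.antidiagonal 3).over K) u ⟨stdLattice K 3, 0, isSelfDualLattice_stdLattice_three_of_v hϖ⟩) ∧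
        ∃ κ : unitaryGroupOfForm σ ((StdForm.antidiagonal 3).over K), κ ∈ unitaryInt σ ((StdForm.antidiagonal 3).over K) ∧
          w.1 = mapGL (((u * κ : unitaryGroupOfForm σ ((StdForm.antidiagonal 3).over K)) : GL (Fin 3) K)) (latt (Matrix.diagonal ![(1 : K), 1, ϖ])) ∧
          ∃ t₀ : 𝒪[K], (t₀ : K) = (ϖ ^ d)⁻¹ * B₀ σ 3 (((κ : GL (Fin 3) K) : Matrix (Fin 3) (Fin 3) K) *ᵥ (Pi.single 0 1))
              (M *ᵥ (((κ : GL (Fin 3) K) : Matrix (Fin 3) (Fin 3) K) *ᵥ (Pi.single 0 1))) ∧ IsLocalRing.residue 𝒪[K] t₀ = 0}.ncard = 1 := by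
  classical
  haveI : Fintype 𝓀[K] := Fintype.ofFinite _
  rw [ncard_neighborSet_pred_eq_natCard hσ hvσ hσϖ hϖ hres h2 u M Y₀ hY₀ (fun s => s = 0) (fun a s ha => by simp [ha])]
  exact natCard_params_null_eq_one_of_shape_top (ringChar_residueField_ne_two h2) _ hc t hl hshape

/-- **TOP VERTEX: `q·[χ(c₀l) = σ]` children whose line value has class `σ` for the key `c₀`** (`c = 0`: all `q` non-block lines lie in the ONE class of `l`).
[cite: Kottwitz1986, §3] [cite: Rogawski1990, §4.9 Prop. 4.9.1 (b) p. 55] [cite: IrelandRosen1990, Ch. 8 §1] -/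
theorem ncard_children_quadraticChar_eq_of_shape_top (hσ : ∀ x, σ (σ x) = x) (hvσ : ∀ a, Valued.v (σ a) = Valued.v a) (hσϖ : σ ϖ = -ϖ)
    (hϖ : Valued.v ϖ = WithZero.exp (-1 : ℤ)) (hres : ∀ x : K, Valued.v x ≤ 1 → Valued.v (σ x - x) < 1) (h2 : Valued.v (2 : K) = 1) [Fintype 𝓀[K]] [DecidableEq 𝓀[K]]
    (u : unitaryGroupOfForm σ ((StdForm.antidiagonal 3).over K))
    {d : ℕ} (M : Matrix (Fin 3) (Fin 3) K) (Y₀ : Matrix (Fin 3) (Fin 3) 𝒪[K]) (hY₀ : ∀ i j, ((Y₀ i j : 𝒪[K]) : K) = (ϖ ^ d)⁻¹ * M i j)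
    {c : 𝓀[K]} (hc : c = 0) (t l : 𝓀[K])
    (hshape : ∀ x : Fin 3 → 𝓀[K], 2 * x 0 * x 2 + x 1 ^ 2 = 0 →
      x ⬝ᵥ ((((StdForm.antidiagonal 3).over 𝓀[K]) * Y₀.map (IsLocalRing.residue 𝒪[K])) *ᵥ x) = c * (x 1 + t * x 2) ^ 2 + l * x 2 ^ 2)
    (c₀ : 𝓀[K]) {τ : ℤ} (hτ : τ = 1 ∨ τ = -1) :
    {w | w ∈ (latticeGraph σ ϖ ((StdForm.antidiagonal 3).over K)).neighborSet
          (latticeGraphIso σ ϖ ((StdForm.antidiagonal 3).over K) u ⟨stdLattice K 3, 0, isSelfDualLattice_stdLattice_three_of_v hϖ⟩) ∧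
        ∃ κ : unitaryGroupOfForm σ ((StdForm.antidiagonal 3).over K), κ ∈ unitaryInt σ ((StdForm.antidiagonal 3).over K) ∧
          w.1 = mapGL (((u * κ : unitaryGroupOfForm σ ((StdForm.antidiagonal 3).over K)) : GL (Fin 3) K)) (latt (Matrix.diagonal ![(1 : K), 1, ϖ])) ∧
          ∃ t₀ : 𝒪[K], (t₀ : K) = (ϖ ^ d)⁻¹ * B₀ σ 3 (((κ : GL (Fin 3) K) : Matrix (Fin 3) (Fin 3) K) *ᵥ (Pi.single 0 1))
              (M *ᵥ (((κ : GL (Fin 3) K) : Matrix (Fin 3) (Fin 3) K) *ᵥ (Pi.single 0 1))) ∧ quadraticChar 𝓀[K] (c₀ * IsLocalRing.residue 𝒪[K] t₀) = τ}.ncard =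
      Fintype.card 𝓀[K] * (if quadraticChar 𝓀[K] (c₀ * l) = τ then 1 else 0) := by
  have hP : ∀ a s : 𝓀[K], a ≠ 0 → (quadraticChar 𝓀[K] (c₀ * (a * a * s)) = τ ↔ quadraticChar 𝓀[K] (c₀ * s) = τ) := fun a s ha => by
    rw [show c₀ * (a * a * s) = c₀ * s * a ^ 2 by ring, map_mul, map_pow, quadraticChar_sq_one ha, mul_one]
  rw [ncard_neighborSet_pred_eq_natCard hσ hvσ hσϖ hϖ hres h2 u M Y₀ hY₀ (fun s => quadraticChar 𝓀[K] (c₀ * s) = τ) hP]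
  exact natCard_params_quadraticChar_eq_of_shape_top (ringChar_residueField_ne_two h2) _ hc t l hshape c₀ hτ

end Lattice

end Literature.NumberTheory.Automorphic.UnitaryLatticeTree

end
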